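import Mathlib
import HarnessLib
import HarnessLib.Audit
import Summits.ABC.ABC.Statement

/-!
Route: ThinOrbitABC

CLOSED (retired) 2026-08-15T13:36:02Z by operator:999:1090267 — reason: not-a-thesis: assembly does not conclude the sub-problem Statement — note: D-0027 §2.1 audit (human 2026-08-15: routes that do not decide the summit are removed): the assembly concludes `AlmostAllThinOrbitABC`, not the sub-problem statement; a NEW conforming route may be opened from the same idea (generated `closes : … → _root_.ABC`).. The file is kept as the record of this route; refuted decls are indexed as negative knowledge (`ledger negatives`).

ThinOrbitABC (realises idea card ABC/ABC/thin-orbit-abc-exceptions). CONSEQUENCE-SIDE,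
necessary-direction route: NO arrow X → Summit.ABC is claimed. The arrow is ABC ⟹ X (support item
AbcImpliesTarget, provable now), so X is an unconditional abc-type theorem-candidate in a regime
where nothing is known, and ¬X for a single digit set A would refute ABC.
OBJECTS. For a finite digit set A ⊂ ℕ≥1 with |A| ≥ 2, the continued-fraction (Zaremba) semigroup
orbit 𝒪_A ⊂ ℕ² is the set of pairs (x, y) = (p_k, q_k) = second column of g_{a₁}⋯g_{a_k}, g_a = (0
1; 1 a), a_i ∈ A, k ≥ 1 (numerator and denominator of [0; a₁, …, a_k]); x, y ≥ 1 are coprime, so (x,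
y, x+y) is an abc triple. N_A(X) := #{(x,y) ∈ 𝒪_A : x + y ≤ X} ≍ X^{2δ_A}, δ_A = Hausdorff dimension
of the limit set (Hensley; δ_{1,2} = 0.531…; for two letters N_A(X) ≤ 2·X^{log 2/log min A}, and
numerically N_{3,4}(X) ≈ X^{0.55}).
X = AlmostAllThinOrbitABC: for every such A and every ε > 0 there is η = η(A, ε) > 0 with #{(x,y) ∈
𝒪_A : x + y ≤ X, quality(x, y, x+y) ≥ 1 + ε} ≤ C·X^(−η)·N_A(X) for all X ≥ 1 — abc holds in every
continued-fraction thin orbit off a power-saving exceptional set.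
WHY THIS TARGET. The global exceptional-set counts (de Bruijn: ≪ X^{2/3+o(1)};
[BernertBrowningLichtmanTeravainen2024, Thm 1.2]: ≪ X^{33/50}) give X for free exactly when N_A(X) ≥
X^{0.66+κ} (support item GlobalCountRegime, provable now) and say nothing when N_A(X) ≤ X^{0.66} —
e.g. for EVERY two-letter A ⊆ {3, 4, 5, …}: structured families invisible to counting. Thin orbits
carry a second structure, EXPANSION (super-strong approximation: the orbit equidistributes mod q for
all q ≤ X^c with power saving [MageeOhWinter2019, BourgainVarju2012, BourgainGamburdSarnak2009]),
and the radical enters only through the local densities ρ(p^k) ≍ 3/p^k of the three linear forms x,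
y, x+y on the orbit.
IT SUFFICES TO SHOW (Assembly, a two-line union bound): T(A) = SmallRepeatedPrimesSparse —
exceptions all of whose repeated primes are ≤ X^θ are X^(−η)-sparse (the expansion half: quality ≥
1+ε forces a POWERFUL divisor d | xy(x+y) with X^σ ≤ d ≤ X^{3σ} inside the equidistribution range,
and powerful moduli are summable: Σ 3^{ω(d)}/d over powerful d ≥ X^σ is X^{−σ/2+o(1)}) — and LoD₂⁺ =
LargeSquareSparse — members with a prime square p² | xy(x+y), p > X^θ, are X^(−η)-sparse for every θ
> 0 (the ONE affine-sieve axiom: a level of distribution of the orbit for prime-square moduli up to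
X, far beyond the expansion range). T(A) is in turn reduced (support ExpansionUnionBound, provable
now) to GoodModuliLevel (printed: [MageeOhWinter2019, Thm 2 and Thm 11 with the
Bourgain–Kontorovich–Magee appendix], moduli coprime to a bad modulus Q₀(A)) and the small unprinted
crux BadPrimePowerLevel (equidistribution to high powers of the finitely many bad primes).
LEAN. X := AlmostAllThinOrbitABC as displayed in the route file: the orbit is inlined as {v : ℕ × ℕ
| ∃ w : List ℕ, w ≠ [] ∧ (∀ a ∈ w, a ∈ A) ∧ (w.map fun a => !![0, 1; 1, a]).prod 0 1 = v.1 ∧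
(…).prod 1 1 = v.2} and passed as a hypothesis `∀ O, O = {…} →` (no new definitions needed); counts
are Set.ncard of pairs with v.1 + v.2 ≤ X (finite for free); quality =
Literature.NumberTheory.DiophantineGeometry.quality; all nine decls elaborate (planner Sketch.lean,
lean check rc 0).

Rationale: WHY THIS LINE. Area imported: expansion / super-strong approximation for thin (semi)groups and the
affine sieve [BourgainGamburdSarnak2009, BourgainVarju2012, MageeOhWinter2019,
BourgainKontorovich2014, KontorovichOh2012], pointed at abc exceptional sets — an engine absent from
the ABC tree, whose partial results are Baker-type (Stewart–Yu), modular/Shimura (Pasten) or GLOBAL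
counts (de Bruijn, arXiv:2410.12234, 2506.13364, 2507.02885). In a thin orbit "abc almost surely"
separates cleanly into a spectral-gap statement T(A) plus one sieve axiom LoD₂⁺, the radical
entering only via ρ(p^k) ≍ 3/p^k. Catalogue moves used: probabilistic/equidistribution
reformulation; regime split (small vs large repeated primes); weakening to a density statement in a
family (thought-starters 4, 8, 16, 37). MOW19 was READ (arXiv:1601.03705 pp. 3–5, 8, 19–20, 23: Thm
1/2/11, (q,Q₀)=1, BKM appendix Thm 37); BLT READ (arXiv:2410.12234 p. 3: Prop 1.1, Thm 1.2).
RANKED CRUXES. r2 LargeSquareSparse = LoD₂⁺ (hardest and most informative: prime-square moduli p²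
with p ∈ (X^{δ_A}, X^{1/2}] exceed anything bilinear/dispersion methods reach on an orbit of size
X^{2δ_A}, and pointwise multiplicity bounds make integer counting useless; progress here is new
affine-sieve technology, failure exhibits an orbit correlating with squares). r3
SmallRepeatedPrimesSparse = T(A) (the card's theorem-candidate; a complete chain from expansion;
inherits only the bad-prime risk). r4 BadPrimePowerLevel (the exact unprinted input: MOW19 assumes
(q, Q₀) = 1; high powers p^j ≤ X^c of bad primes need the Bourgain–Varjú-type gap for the
archimedean semigroup count). Support (rank 8–9, unranked for staffing): GoodModuliLevel (printed
input, named-fact grade — grounder: vendor MOW19 Thm 11 as a Literature cite fact and re-file as (h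
: Fact) → …), ExpansionUnionBound (Good → Bad → T; provable now, elementary but long),
AbcImpliesTarget (necessity; provable now), GlobalCountRegime (the free regime N_A(X) ≥ X^{ϑ+κ} from
any global bound X^ϑ; provable now). r0 Target, r1 Assembly: T → LoD₂⁺ → X.
KILL CRITERIA. LoD₂⁺ refuted for some (A, θ) (≫ X^{−o(1)} N_A(X) members with p² | xy(x+y), p > X^θ,
along X → ∞) ⇒ the sieve axiom is false: close `refuted:LargeSquareSparse` (a restate with θ = θ(ε)
is allowed only if the witness lives at θ bounded away from the T(A) range). BadPrimePowerLevel
refuted (a bad prime power p^j capturing ≫ p^{−j} X^{o(1)} of 𝒪_A) ⇒ restate T and the Assembly with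
the bad-prime part of the powerful excess excluded and record the concentration as a Literature
fact; T refuted directly ⇒ same repair. X refuted for one A ⇒ ¬ABC via AbcImpliesTarget — report
upward, no repair. External check (card E1, kit job filed on the Target item): enumerate 𝒪_{3,4},
𝒪_{2,5}, 𝒪_{4,5}, 𝒪_{2,4} to x+y ≤ 10^11–10^12 and controls 𝒪_{1,2}, 𝒪_{1,3}; list quality ≥ 1
members with their largest repeated prime P₂ — LoD₂⁺ predicts almost none with P₂ > c^{0.3}; a
positive proportion would kill the line cheaply.
NOT DECOMPOSED YET. (i) LoD₂⁺ by ranges — p ≤ X^{δ_A−} via bilinear forms γ = γ₁γ₂ and dispersion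
mod p² à la [BourgainKontorovich2014], versus the window (X^{δ_A}, X^{1/2}] where no method exists;
(ii) the thin Pythagorean/orthogonal orbits of [KontorovichOh2012] (square triples ((u²−v²)²,
(2uv)², (u²+v²)²), card K2): same mechanism on a quartic form — a sibling route if this one moves;
(iii) Schottky subgroups instead of CF semigroups; (iv) the growth lemmas (N_A(Y) ≥ cY^κ;
N_A(√X)·N_A(√X/2) ≤ C log X · N_A(X) by concatenation) and the positivity/coprimality of orbit pairs
((x,y) ↦ (y, x+ay) from (1,a₀)) ride as `--supports` lemmas, not items.
NOVELTY and BARRIERS: see the dedicated sections (searched before claimed; card audit grade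
new-combination).

Novelty: Nearest prior art FOUND and read: arXiv:2410.12234 = BernertBrowningLichtmanTeravainen2024 (global
exceptional set ≪ X^{33/50}, Thm 1.2; with de Bruijn's X^{2/3} Prop 1.1 it is the source of the
"N_A(X) ≤ X^{0.66} ⇒ every global count is vacuous" threshold); arXiv:2506.13364, arXiv:2507.02885
(global exponents 0.65, 8/13); MageeOhWinter2019 = arXiv:1601.03705 (Thm 1/2/11: uniform
power-saving congruence counting for Schottky and continued-fraction semigroups, (q,Q₀)=1, BKM
appendix); BourgainKontorovich2014 = arXiv:1107.3776 (Zaremba; bilinear level of distribution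
X^{small}); KontorovichOh2012 = arXiv:1001.0370 (affine sieve on thin Pythagorean orbits);
BourgainGamburdSarnak2009; BourgainVarju2012. Searches (this session): zbMATH "power-free values
thin orbits" (0 hits), "squarefree sieve thin group orbit" (only Fuchs 2011, strong approximation
for the Apollonian group), "abc conjecture continued fractions bounded partial quotients" (0),
"exceptional set abc conjecture" (the global-count papers above), "uniform congruence counting
Schottky semigroups" (MOW19, Sarkar 2025 SO(n,1)); `lit galaxy search --star all "abc conjecture
thin orbit"` (0 rows in panama/pdf/crabby); `lit frontier ABC --since 2020` and `lit bridges ABC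
--cross any` (no thin-group or affine-sieve descendants of the ABC roots); plus the card audit
(refuter-novelty-audit-ABC-ABC-14: zbMATH ×6 incl. "abc conjecture thin groups" 0, "affine sieve
squarefree", galaxy pdf bm25, local hybrid — nothing joint; neares  [refs: 2410.12234, 2506.13364, 2507.02885, 1601.03705, 1107.3776, 1001.0370, BernertBrowningLichtmanTeravainen2024, MageeOhWinter2019, BourgainKontorovich2014, KontorovichOh2012, BourgainGamburdSarnak2009, BourgainVarju2012]

Barriers (technique_class: affine-sieve-expansion thin-orbit-exceptional-set): technique_class: affine-sieve-expansion thin-orbit-exceptional-set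
Catalogue Literature/Barriers/ABC read 2026-08-15 (27 files); negatives index `ledger negatives
--problem ABC`: 0 refuted statements.
- Literature.Barriers.ABC.BakerMethodBounds: not engaged — no linear forms in logarithms anywhere;
the hypothesis quality ≥ 1+ε is used only to produce a powerful divisor of xy(x+y) of size X^σ,
never to bound c from the radical.
- Literature.Barriers.ABC.EpsilonCannotBeDropped: respected — every item keeps ε > 0 AND allows an
exceptional set of size C·X^(−η)·N_A(X); Stewart–Tijdeman/van Frankenhuysen/Bright families have
quality → 1, so they are not counted at quality ≥ 1+ε, and where members of such families lie in 𝒪_A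
they are X^{o(1)} in number, inside the allowance.
- ExplicitABCQualityFloor / HallExponentSharp / NConjectureExponentSharp / ErdosWoodsTwoFails /
TijdemanZagierNeedsExponentThree: not engaged — no constant-1, ε-free, Hall, n-term or Beal-type
inequality is asserted for all triples.
- MasonStothersFailsInCharP, NoArithmeticDerivative: not engaged — no function-field transfer or
derivation.
- IUTDisputedClaim: not engaged — nothing imported from IUT.
- SzpiroEpsilonCannotBeDropped, UniformABCDiscriminantSharp, UniformABCImpliesNoSiegelZeros: not
engaged — no Szpiro/uniform-abc content.
Honest limit: the line evades no barrier because it does not attack S itself (consequence side: ABC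
⟹ X); the bet is that thin orbits are exactly where an abc-type DENSITY theorem

History (route lifecycle, newest last):
- 2026-08-15T13:36:03Z · CLOSED retired — not-a-thesis: assembly does not conclude the sub-problem Statement (operator:999:1090267)

sub-problem: ABC · status: closed(retired) · opened planner-plancard-ABC-ABC-thin-orbit-abc-excep-4be02e06-0 2026-08-15T11:11:47Z · rev 1 · ledger route-ABC-ThinOrbitABC
GENERATED by the gate from the ledger (D-0016/17). Provers cite these decls: `theorem foo : Summit.ABC.ABC.Theses.ThinOrbitABC.<Decl> := …` in Summits/ABC/ABC/Theorems/<Name>.lean.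
-/

namespace Summit.ABC.ABC.Theses.ThinOrbitABC

open scoped BigOperators Topology Manifold Classical MeasureTheory ProbabilityTheory Matrix InnerProductSpace ComplexConjugate ContinuousMap
open Filter Set Function TopologicalSpace MeasureTheory

attribute [summit_statement] _root_.ABC

open Literature.Abc

/-- item stmt-ABC-3126 · target · rank 0 · closed · moot by None · by planner
why it might fail: False only if ABC is (AbcImpliesTarget: ¬X for one A yields infinitely many quality ≥ 1+ε triples). As filed it inherits the open prime-square window of LargeSquareSparse and, for a Lean closure, the unformalised printed input GoodModuliLevel (MOW19 Thm 11): expect closure only as (h : fact) → X.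
sources: BernertBrowningLichtmanTeravainen2024, MageeOhWinter2019, BourgainKontorovich2014, Oesterle1988
[target] Almost-all abc in every continued-fraction thin orbit. For a finite digit set A ⊂ ℕ≥1, |A|
≥ 2, 𝒪_A ⊂ ℕ² = pairs (x,y) = (p_k,q_k) = second column of g_{a₁}⋯g_{a_k}, g_a = (0 1;1 a), a_i ∈ A,
k ≥ 1 (numerator/denominator of [0;a₁,…,a_k]; x, y ≥ 1 coprime, so (x, y, x+y) is an abc triple);
N_A(X) = #{(x,y) ∈ 𝒪_A : x+y ≤ X} ≍ X^{2δ_A} (Hensley), N_{3,4}(X) ≈ X^{0.55}. CLAIM X: ∀ A ∀ ε>0 ∃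
η>0, C: #{(x,y) ∈ 𝒪_A : x+y ≤ X, quality(x,y,x+y) ≥ 1+ε} ≤ C·X^(−η)·N_A(X). CONSEQUENCE-SIDE: ABC ⟹
X (AbcImpliesTarget), so ¬X for one A refutes ABC; when N_A(X) ≥ X^{0.66+κ} it follows from
[BernertBrowningLichtmanTeravainen2024, Thm 1.2] (GlobalCountRegime); for every two-letter A ⊆
{3,4,5,…} (N_A(X) ≤ 2X^{0.631}) nothing is known. In Lean the orbit is passed as `∀ O, O = {…} →`
with the matrix product inlined; counts are Set.ncard over pairs with v.1+v.2 ≤ X (finite). Why it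
might fail: no structural reason (implied by ABC); kit experiment E1 attached as evidence. -/
@[route_item "route-ABC-ThinOrbitABC"]
def AlmostAllThinOrbitABC : Prop :=
  ∀ A : Finset ℕ, (∀ a ∈ A, 1 ≤ a) → 2 ≤ A.card → ∀ O : Set (ℕ × ℕ), O = {v : ℕ × ℕ | ∃ w : List ℕ, w ≠ [] ∧ (∀ a ∈ w, a ∈ A) ∧ (w.map fun a : ℕ => !![0, 1; 1, a]).prod 0 1 = v.1 ∧ (w.map fun a : ℕ => !![0, 1; 1, a]).prod 1 1 = v.2} → ∀ ε : ℝ, 0 < ε → ∃ η : ℝ, 0 < η ∧ ∃ C : ℝ, ∀ X : ℕ, 1 ≤ X → (({v ∈ O | v.1 + v.2 ≤ X ∧ 1 + ε ≤ Literature.NumberTheory.DiophantineGeometry.quality v.1 v.2 (v.1 + v.2)}).ncard : ℝ) ≤ C * (X : ℝ) ^ (-η) * (({v ∈ O | v.1 + v.2 ≤ X}).ncard : ℝ)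

/-- item stmt-ABC-3127 · crux · rank 2 · closed · moot by None · by planner
why it might fail: Regime 2δ_A ≤ 0.66: nothing covers p ∈ (X^{c/2}, X^{1/2}]. Expansion stops at p² ≤ X^c [MOW19]; the one printed square-free sieve on Γ_A [BE-II: exponent 1/34] passes to SL₂(Z) after Cauchy–Schwarz, needs δ_A near 1; trivial tails need p > X^{1−δ_A}. False iff an 𝒪_A correlates with squares.
sources: BourgainKontorovich2017, BourgainKontorovich2018, Kontorovich2014, BourgainKontorovich2014, MageeOhWinter2019, Hensley1992
[crux] LoD₂⁺, the one affine-sieve axiom: for every A and every θ > 0 there is η > 0 with #{(x,y) ∈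
𝒪_A : x+y ≤ X, ∃ prime p > X^θ with p² | xy(x+y)} ≤ C·X^(−η)·N_A(X). Heuristic truth X^(−θ)
(Σ_{p>X^θ} 3/p²). Equivalent in substance to an averaged level of distribution of the orbit for
prime-square moduli p² up to X — far beyond the expansion range X^c: for p ≤ X^{c/2} it follows from
GoodModuliLevel, the content is p ∈ (X^{c/2}, X^{1/2}]. Upper bound only, averaged over p; x, y, x+y
pairwise coprime so p² | xy(x+y) iff p² divides one of them. Sources: BourgainKontorovich2014
(bilinear forms on Γ_A, levels X^{small}), KontorovichOh2012, MageeOhWinter2019,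
BourgainGamburdSarnak2009 (affine sieve). -/
@[route_item "route-ABC-ThinOrbitABC"]
def LargeSquareSparse : Prop :=
  ∀ A : Finset ℕ, (∀ a ∈ A, 1 ≤ a) → 2 ≤ A.card → ∀ O : Set (ℕ × ℕ), O = {v : ℕ × ℕ | ∃ w : List ℕ, w ≠ [] ∧ (∀ a ∈ w, a ∈ A) ∧ (w.map fun a : ℕ => !![0, 1; 1, a]).prod 0 1 = v.1 ∧ (w.map fun a : ℕ => !![0, 1; 1, a]).prod 1 1 = v.2} → ∀ θ : ℝ, 0 < θ → ∃ η : ℝ, 0 < η ∧ ∃ C : ℝ, ∀ X : ℕ, 1 ≤ X → (({v ∈ O | v.1 + v.2 ≤ X ∧ ∃ p : ℕ, p.Prime ∧ (X : ℝ) ^ θ < (p : ℝ) ∧ p ^ 2 ∣ v.1 * v.2 * (v.1 + v.2)}).ncard : ℝ) ≤ C * (X : ℝ) ^ (-η) * (({v ∈ O | v.1 + v.2 ≤ X}).ncard : ℝ)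

/-- item stmt-ABC-3129 · crux · rank 4 · closed · moot by None · by planner
why it might fail: Unprinted for p | Q₀(A): MOW19 Thm 4/Prop 42 and BKM Thm 37 need (q,Q₀)=1 (image SL₂(Z/q), new space E_q). Expansion of π_q(Γ) for ALL q is printed [BV12 Thm 1; BG08]; the gap is the transfer-operator/quasi-randomness step for the proper image H ⊂ SL₂(Z_p) mod p^j, uniform in j: may degrade in j.
sources: MageeOhWinter2019, BourgainVarju2012, BourgainGamburd2008, SalehiGolsefidy2019
[crux] Equidistribution to high prime powers at EVERY prime: ∀ A ∀ prime p ∃ c>0, C: ∀ X ≥ 1 ∀ j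
with p^j ≤ X^c: #{(x,y) ∈ 𝒪_A : x+y ≤ X, p^j | xy(x+y)} ≤ C·(p^{−j} + X^{−c})·N_A(X) (C may depend
on A and p). For p ∤ Q₀(A) this is contained in GoodModuliLevel [MageeOhWinter2019, Thm 2 + Thm 11 +
BKM appendix]; the content is the finitely many bad primes p | Q₀(A) (strong approximation of Γ_A
fails mod p, e.g. p = 2 for A = {2,4}, or the transfer-operator bounds were not run there): uniform
spectral gap of the congruence transfer operators mod p^j, j → ∞ — a Bourgain–Varjú-type input
[BourgainVarju2012] for the archimedean semigroup count. The local distortion (index of the closure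
of ⟨Γ_A⟩ in SL₂(ℤ_p), finite by strong approximation for Zariski-dense ⟨Γ_A⟩) is absorbed in C. -/
@[route_item "route-ABC-ThinOrbitABC"]
def BadPrimePowerLevel : Prop :=
  ∀ A : Finset ℕ, (∀ a ∈ A, 1 ≤ a) → 2 ≤ A.card → ∀ O : Set (ℕ × ℕ), O = {v : ℕ × ℕ | ∃ w : List ℕ, w ≠ [] ∧ (∀ a ∈ w, a ∈ A) ∧ (w.map fun a : ℕ => !![0, 1; 1, a]).prod 0 1 = v.1 ∧ (w.map fun a : ℕ => !![0, 1; 1, a]).prod 1 1 = v.2} → ∀ p : ℕ, p.Prime → ∃ c : ℝ, 0 < c ∧ ∃ C : ℝ, ∀ X : ℕ, 1 ≤ X → ∀ j : ℕ, ((p ^ j : ℕ) : ℝ) ≤ (X : ℝ) ^ c → (({v ∈ O | v.1 + v.2 ≤ X ∧ p ^ j ∣ v.1 * v.2 * (v.1 + v.2)}).ncard : ℝ) ≤ C * (((p ^ j : ℕ) : ℝ)⁻¹ + (X : ℝ) ^ (-c)) * (({v ∈ O | v.1 + v.2 ≤ X}).ncard : ℝ)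

/-- item stmt-ABC-3128 · support · rank 3 · closed · moot by None · by planner
why it might fail: Only as strong as equidistribution of 𝒪_A to ALL moduli ≤ X^c incl. high powers of the bad primes of Γ_A (BadPrimePowerLevel — not in print: MOW19 needs (q,Q₀)=1). If for some A the powerful excess of xy(x+y) concentrates on bad primes for ≫X^{-o(1)}N_A(X) members, T(A) fails as stated.
sources: MageeOhWinter2019, BourgainVarju2012, BourgainGamburdSarnak2009
[crux] T(A), the expansion half (the card's theorem-candidate): ∀ A ∀ ε>0 ∃ θ>0, η>0, C: #{(x,y) ∈
𝒪_A : x+y ≤ X, quality ≥ 1+ε, every prime p with p² | xy(x+y) has p ≤ X^θ} ≤ C·X^(−η)·N_A(X).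
Mechanism: quality ≥ 1+ε ⟹ P := xy(x+y) has P/rad P ≥ (x+y)^{ε/(1+ε)}, so for x+y > √X the powerful
part of P is ≥ X^{ε'}; greedily (all repeated primes ≤ X^θ, θ = σ/2) P has a POWERFUL divisor d with
X^σ ≤ d ≤ X^{3σ} ≤ X^c inside the equidistribution range; union bound with local density ≲
3^{ω(d)}X^ν/d and #{powerful ≤ D} ≪ √D saves X^{−σ/4}; members with x+y ≤ √X are ≤ N_A(√X) ≤
X^{−κ/3}N_A(X) by concatenation sub-multiplicativity; powerful parts concentrated on bad primes go
through BadPrimePowerLevel. Intended proof: support item ExpansionUnionBound (GoodModuliLevel →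
BadPrimePowerLevel → this). Sources: MageeOhWinter2019 Thm 2/11, BourgainVarju2012,
BourgainGamburdSarnak2009. -/
@[route_item "route-ABC-ThinOrbitABC"]
def SmallRepeatedPrimesSparse : Prop :=
  ∀ A : Finset ℕ, (∀ a ∈ A, 1 ≤ a) → 2 ≤ A.card → ∀ O : Set (ℕ × ℕ), O = {v : ℕ × ℕ | ∃ w : List ℕ, w ≠ [] ∧ (∀ a ∈ w, a ∈ A) ∧ (w.map fun a : ℕ => !![0, 1; 1, a]).prod 0 1 = v.1 ∧ (w.map fun a : ℕ => !![0, 1; 1, a]).prod 1 1 = v.2} → ∀ ε : ℝ, 0 < ε → ∃ θ : ℝ, 0 < θ ∧ ∃ η : ℝ, 0 < η ∧ ∃ C : ℝ, ∀ X : ℕ, 1 ≤ X → (({v ∈ O | v.1 + v.2 ≤ X ∧ 1 + ε ≤ Literature.NumberTheory.DiophantineGeometry.quality v.1 v.2 (v.1 + v.2) ∧ ∀ p : ℕ, p.Prime → p ^ 2 ∣ v.1 * v.2 * (v.1 + v.2) → (p : ℝ) ≤ (X : ℝ) ^ θ}).ncard : ℝ) ≤ C * (X : ℝ) ^ (-η)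 * (({v ∈ O | v.1 + v.2 ≤ X}).ncard : ℝ)

/-- item stmt-ABC-3130 · support · rank 8 · closed · moot by None · by planner
sources: MageeOhWinter2019, BourgainVarju2012, BourgainGamburdSarnak2009
[support] Named-fact grade (printed; grounder: please vendor MOW19 Thm 11 as a Literature cite fact
and re-file this as (h : Fact) → …). Uniform power-saving level of distribution of 𝒪_A for
divisibility conditions d₁ | x, d₂ | y, d₃ | x+y with (d₁d₂d₃, Q₀) = 1 and d₁d₂d₃ ≤ X^c: count ≤
C_ν·(X^ν/(d₁d₂d₃) + X^{−c})·N_A(X). Source: [MageeOhWinter2019]: Thm 2 (the CF semigroup Γ_A = even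
words in g_a, a ∈ A, |A| ≥ 2) and Thm 11 (each residue class ξ mod q, (q,Q₀)=1, error q^C R^{2δ−ε}),
arbitrary such q by the Bourgain–Kontorovich–Magee appendix (Thm 37). Translation steps (routine):
pairs vs words (≤ 2:1 by uniqueness of finite continued fractions), x+y ≤ X vs Frobenius balls ‖γ‖ ≤
R (‖M_w‖ ≍ y ≤ x+y ≤ 2y; doubling is harmless for upper bounds), odd-length words = (even word)·g_a,
local density of {d₁|x, d₂|y, d₃|x+y} among the attained residues mod d₁d₂d₃ ≤ K^{ω(d)}/(d₁d₂d₃) ≤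
X^ν/(d₁d₂d₃) at good primes (non-pairwise-coprime (d_i) give 0 since x, y, x+y are pairwise
coprime). -/
@[route_item "route-ABC-ThinOrbitABC"]
def GoodModuliLevel : Prop :=
  ∀ A : Finset ℕ, (∀ a ∈ A, 1 ≤ a) → 2 ≤ A.card → ∀ O : Set (ℕ × ℕ), O = {v : ℕ × ℕ | ∃ w : List ℕ, w ≠ [] ∧ (∀ a ∈ w, a ∈ A) ∧ (w.map fun a : ℕ => !![0, 1; 1, a]).prod 0 1 = v.1 ∧ (w.map fun a : ℕ => !![0, 1; 1, a]).prod 1 1 = v.2} → ∃ Q₀ : ℕ, 0 < Q₀ ∧ ∃ c : ℝ, 0 < c ∧ ∀ ν : ℝ, 0 < ν → ∃ C : ℝ, ∀ X : ℕ, 1 ≤ X → ∀ d₁ d₂ d₃ : ℕ, 0 < d₁ → 0 < d₂ → 0 < d₃ → Nat.Coprime (d₁ * d₂ * d₃) Q₀ → ((d₁ * d₂ * d₃ : ℕ) : ℝ) ≤ (X : ℝ) ^ c → (({v ∈ O | v.1 + v.2 ≤ X ∧ d₁ ∣ v.1 ∧ d₂ ∣ v.2 ∧ d₃ ∣ v.1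 + v.2}).ncard : ℝ) ≤ C * ((X : ℝ) ^ ν / ((d₁ * d₂ * d₃ : ℕ) : ℝ) + (X : ℝ) ^ (-c)) * (({v ∈ O | v.1 + v.2 ≤ X}).ncard : ℝ)

/-- item stmt-ABC-3131 · support · rank 9 · closed · moot by None · by planner
sources: MageeOhWinter2019
[support] GoodModuliLevel → BadPrimePowerLevel → SmallRepeatedPrimesSparse: the powerful-divisor
union bound; provable now (elementary, long). Sketch, for fixed A, O, ε with Q₀, c, C_ν from Good
and c_p, C_p (p | Q₀) from Bad: (1) x+y ≤ √X: N_A(√X)·N_A(√X/4) ≤ C·log X·N_A(X) (concatenation: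
c(w'w) ≤ 4c(w')c(w); for fixed w' the map v ↦ M_{w'}v on pairs is injective (det M_{w'} = ±1), and a
pair v has ≤ 2·length ≤ C log X peelings v = M_{w'}u with u in the orbit, the digit being forced: a
= ⌊(y−1)/x⌋) and N_A(Y) ≥ cY^κ (2^{k−1} distinct pairs from words over two letters a<b with
innermost letter b, y ≤ (b+1)^k) ⟹ N_A(√X) ≤ C·X^{−κ/3}·N_A(X). (2) x+y > √X and quality ≥ 1+ε ⟹ P
:= xy(x+y) has P/rad P ≥ X^{ε'}, ε' = ε/(2(1+ε)), so pow(P) := ∏_{v_p≥2} p^{v_p} ≥ X^{ε'}. (3) σ :=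
min(ε', c, min_p c_p)/8, θ := σ/2. If pow_good(P) (primes ∤ Q₀) ≥ X^σ: greedy m | pow_good(P) with
X^σ ≤ m < X^{σ+θ} (all repeated primes ≤ X^θ by hypothesis), d := ∏_{p|m} p^{max(v_p(m),2)} is
powerful, coprime to Q₀, d | P, X^σ ≤ d ≤ m² ≤ X^{3σ} ≤ X^c; d | xy(x+y) iff some pairwise-coprime
factorisation d = d₁d₂d₃ has d₁|x, d₂|y, d₃|x+y (≤ 3^{ω(d)} of them); sum GoodModuliLevel with ν =
σ/8 over powerful d ∈ [X -/
@[route_item "route-ABC-ThinOrbitABC"]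
def ExpansionUnionBound : Prop :=
  GoodModuliLevel → BadPrimePowerLevel → SmallRepeatedPrimesSparse

/-- item stmt-ABC-3132 · support · rank 9 · closed · moot by None · by planner
sources: Oesterle1988, BernertBrowningLichtmanTeravainen2024
[support] Necessity, provable now: ABC → AlmostAllThinOrbitABC. ABC at ε/2 bounds c = x+y for every
quality ≥ 1+ε triple (c < C·c^{(1+ε/2)/(1+ε)}), so the exceptions of 𝒪_A lie in the finite set {v :
v.1+v.2 ≤ B(ε)}; and N_A(X) ≥ X^κ/4 for X ≥ X₀ (words over two letters a < b of A with innermost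
letter b give pairwise distinct pairs — the step (x,y) ↦ (y, x+ay) is inverted by a = ⌊(y'−1)/x'⌋
when x < y — and y ≤ (b+1)^k), whence ≤ C·X^(−κ)·N_A(X) (take C ≥ X₀^κ·B² for small X). Lemma to
record on the way (useful to every item): orbit pairs satisfy 1 ≤ x ≤ y, gcd(x,y) = 1 (induction on
(x,y) ↦ (y, x+ay) from (1,a₀); List.prod_cons), i.e. IsABCTriple x y (x+y). Makes the contrapositive
available: ¬AlmostAllThinOrbitABC (for one A) ⟹ ¬ABC. -/
@[route_item "route-ABC-ThinOrbitABC"]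
def AbcImpliesTarget : Prop :=
  _root_.ABC → AlmostAllThinOrbitABC

/-- item stmt-ABC-3133 · support · rank 9 · closed · moot by None · by planner
sources: BernertBrowningLichtmanTeravainen2024
[support] OBSERVATION 1 of the card made formal, provable now: a global exceptional-set bound #{abc
triples (a,b,c) : c ≤ X, quality ≥ 1+ε} ≤ C_ε·X^ϑ (hypothesis; ϑ = 33/50 is
[BernertBrowningLichtmanTeravainen2024, Thm 1.2] since quality ≥ 1+ε means rad(abc) ≤ c^{1/(1+ε)} <
c, i.e. exponent λ = 1 there; ϑ = 2/3 + o(1) is the de Bruijn-type trivial bound, their Prop 1.1)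
together with orbit growth N_A(X) ≥ c₀X^{ϑ+κ} for X ≥ X₀ gives the Target's conclusion for A with
saving X^(−κ): pairs ↦ triples (x, y, x+y) is injective and orbit pairs are abc triples (positive,
coprime). Shows the route's content is exactly the alphabets with N_A(X) ≤ X^ϑ, e.g. every
two-letter A ⊆ {3,4,…} (N_A(X) ≤ 2·X^{log 2/log min A} ≤ 2X^{0.631}). -/
@[route_item "route-ABC-ThinOrbitABC"]
def GlobalCountRegime : Prop :=
  ∀ ϑ : ℝ, 0 < ϑ → (∀ ε : ℝ, 0 < ε → ∃ C : ℝ, ∀ X : ℕ, (({t : ℕ × ℕ × ℕ | Literature.NumberTheory.DiophantineGeometry.IsABCTriple t.1 t.2.1 t.2.2 ∧ t.2.2 ≤ X ∧ 1 + ε ≤ Literature.NumberTheory.DiophantineGeometry.quality t.1 t.2.1 t.2.2}).ncard : ℝ) ≤ C * (X : ℝ) ^ ϑ) → ∀ A : Finset ℕ, (∀ a ∈ A, 1 ≤ a) → 2 ≤ A.card → ∀ O : Set (ℕ × ℕ), O = {v : ℕ × ℕ | ∃ w : List ℕ, w ≠ [] ∧ (∀ a ∈ w, a ∈ A) ∧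 (w.map fun a : ℕ => !![0, 1; 1, a]).prod 0 1 = v.1 ∧ (w.map fun a : ℕ => !![0, 1; 1, a]).prod 1 1 = v.2} → (∃ κ : ℝ, 0 < κ ∧ ∃ c₀ : ℝ, 0 < c₀ ∧ ∃ X₀ : ℕ, ∀ X : ℕ, X₀ ≤ X → c₀ * (X : ℝ) ^ (ϑ + κ) ≤ (({v ∈ O | v.1 + v.2 ≤ X}).ncard : ℝ)) → ∀ ε : ℝ, 0 < ε → ∃ η : ℝ, 0 < η ∧ ∃ C : ℝ, ∀ X : ℕ, 1 ≤ X → (({v ∈ O | v.1 + v.2 ≤ X ∧ 1 + ε ≤ Literature.NumberTheory.DiophantineGeometry.quality v.1 v.2 (v.1 + v.2)}).ncard : ℝ) ≤ C * (X : ℝ) ^ (-η) * (({v ∈ O | v.1 + v.2 ≤ X}).ncard : ℝ)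

/-- item stmt-ABC-3134 · assembly · rank 1 · closed · moot by None · by planner
[assembly] SmallRepeatedPrimesSparse → LargeSquareSparse → AlmostAllThinOrbitABC. Glue (easy): given
A, hA, O = orbit, ε: T(A) gives θ, η₁, C₁; LoD₂⁺ at that θ gives η₂, C₂; an exception v either has
every prime p with p² | v.1·v.2·(v.1+v.2) below X^θ (T-set) or some prime above (K-set, since ¬(p ≤
X^θ) ⟺ X^θ < p); {v | v.1 + v.2 ≤ X} is finite so Set.ncard is monotone/subadditive
(Set.ncard_union_le, Set.ncard_le_ncard); X^(−η_i) ≤ X^(−η) for η = min η_i and X ≥ 1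
(Real.rpow_le_rpow_of_exponent_le); C := max C₁ 0 + max C₂ 0. -/
@[route_item "route-ABC-ThinOrbitABC"]
def Assembly : Prop :=
  SmallRepeatedPrimesSparse → LargeSquareSparse → AlmostAllThinOrbitABC

end Summit.ABC.ABC.Theses.ThinOrbitABC
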